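/-
Copyright (c) 2026. All rights reserved.
Released under Apache 2.0 license as described in the file LICENSE.
Authors: abc-iut cell — seat abc-iut-f-068 (block F fact-proving wave, tranche 68: FACT-LIST rows
F-0292 `EllipticModel.Cor_3_4`, F-0293 `EllipticModel.Matches`, F-0294 `EllipticModel.RealizesCore`).
-/
import Literature.AnabelianGeometry.AbsoluteAnabelian.AbsTopII.EllipticCuspidalizationComparison
import Literature.AnabelianGeometry.AbsoluteAnabelian.SubpadicSlimProofs
import Literature.AnabelianGeometry.AbsoluteAnabelian.SubpadicExamples
import Literature.AnabelianGeometry.AbsoluteAnabelian.AbsTopIII.KummerFaithfulSubpadicProofs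
import Literature.AnabelianGeometry.AbsoluteAnabelian.SlimTransport
import Literature.AnabelianGeometry.SemiGraphs.WitnessIwahoriGroup
import Literature.AnabelianGeometry.SemiGraphs.OncePuncturedTemperedGroupPadicWitness
import Mathlib.Topology.Instances.ZMod
import HarnessLib

/-!
# [AbsTopII] Cor 3.3 (i)/(iii), Cor 3.4 over a class `𝒟`: the universal closures of the SCHEMAS
# `EllipticModel.RealizesCore`, `EllipticModel.Matches`, `EllipticModel.Cor_3_4` are FALSE

S. Mochizuki, *Topics in Absolute Anabelian Geometry II*, Cor 3.3 pp. 67–69, Cor 3.4 pp. 69–70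
(bib key `MochizukiAbsTopII2013`).  PROOF-ONLY companion of
`AbsTopII/EllipticCuspidalizationComparison.lean` (no `def`/`instance`/`structure`; every witness is
built inside a theorem).  That file types Cor 3.3 / 3.4 "in their printed generality" over the MODEL
INTERFACE `EllipticModel 𝒟` of a class `𝒟 : ConstructionDataClass` (shape (M): no instance in the
tree; the intended instance is the étale `π₁` of `Π`-elliptically admissible orbicurves).  The cell's
FROZEN FACT-LIST carries three of its `Prop`-valued declarations as parametrised rows: F-0294
`RealizesCore b X c` and F-0293 `Matches s C` are PREDICATES (the defining clauses of Cor 3.3 (i) /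
(iii) on a `Π`-chain `c`, resp. an output `C`), not assertions of print; F-0292 `Cor_3_4` is
Corollary 3.4 RELATIVE TO `(𝒟, M)`.  KERNEL RESULTS: the universal closure of each of the three over
its binders is FALSE (`not_forall_realizesCore`, `not_forall_matches`, `not_forall_cor_3_4`, with
`exists_not_…` forms); per the cell's rule R5 the rows are consumed BY NAME at the intended instance
only (`Cor_3_4` via `cor_3_4_of_ex_4_8_i` / `cor_3_4_of_isSubpadic`, which take `M.Cor_3_4` as a
hypothesis).

COUNTER-MODELS.  (1) `exists_cor_3_4_countermodel` (for `Cor_3_4`, `RealizesCore`): ONE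
construction-data field, the GENUINE `ℚ_p` — so the standing hypotheses on `G = G_{ℚ_p}` are
THEOREMS of the tree: `G_{ℚ_p}` slim (`IsSubpadicFor.isSlimGroup_absoluteGaloisGroup`, [pGC] Lem 15.8)
and `χ_l` with open image (`IsSubpadic.isOpen_range_cyclotomicChar`, [AbsTopIII] Rmk 1.5.1) — one
member with `Π := P × G_{ℚ_p} ↠ G_{ℚ_p}`, `Δ = P := ℤ_p ⋊ (1 + pℤ_p)` (the slim group `Iw p` of
`SemiGraphs/WitnessIwahoriGroup.lean`), `Σ` = all primes, scheme morphisms := the outer isomorphisms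
themselves (rel-isom-DGC tautological), no chain terms (chain-full), and a JUNK model: two settings
with the same `N = 1` whose "natural surjections `Π_{U_X} ↠ Π`" are `id : Π → Π` and the projection
`ℤ/2 × Π ↠ Π`; no `φ_U : Π ⥲ ℤ/2 × Π` lies over `φ = id`, so the conclusion of Cor 3.4 fails although
EVERY typed hypothesis holds, and the length-`0` `Π`-chain of the member has type-chain `[] ≠ [⋎]`.
(2) `exists_not_matches`: the degenerate class over `Q̄` (`G_{Q̄} = 1`, everything subsingleton; the
record of `EllipticCuspidalizationNonVacuity.lean` rebuilt over it), `N = 2` in the setting, `N = 1`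
in the output.

HONEST FRAMING: statements about the cell's own interface typing (a junk model of an abstract schema
falsifies only the schema's universal closure); NOT a claim about the published Corollaries 3.3 / 3.4,
which concern the étale-`π₁` instance the tree does not construct; nothing here bears on
[IUTchIII] Cor 3.12; typed ≠ proved; no side taken.
-/

noncomputable section

open CategoryTheory Topology

namespace Literature.AnabelianGeometry.AbsoluteAnabelian.AbsTopII

open Literature.AlgebraicGeometry.Frobenioids (IsSlimGroup)
open Literature.AnabelianGeometry.Anabelioids (IsSigmaInteger)
open Literature.AnabelianGeometry.SemiGraphs (Iw)
open FundamentalExtension AugmentedProfiniteGrp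
open AbsTopI (ConstructionDataClass)

namespace EllipticModel

/-! ### The `ℚ_p` counter-model: all hypotheses of Cor 3.4 hold, its conclusion fails -/

/-- **Counter-model for the schema `EllipticModel.Cor_3_4`** (and carrier of the `RealizesCore`
refutation): for every prime `p` there are a class `𝒟` (one field: `ℚ_p`; `Σ` = all primes; scheme
isomorphisms := outer isomorphisms of `Π` over `G_{ℚ_p}`; no chain terms), a model `M` and a member `X`
with `Π = P × G_{ℚ_p}`, `Δ = P = ℤ_p ⋊ (1 + pℤ_p)`, such that: `𝒟` is chain-full, the rel-isom-DGC
holds, `X` satisfies the standing hypotheses of Cor 3.3 / 3.4 (`G_{ℚ_p}` slim and `χ_p` open — PROVED in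
the tree; `Δ` slim nontrivial), two settings `s₁, s₂` have the same `Σ ∩ Σ`-integer `N = 1`, the common
prime `l := p` qualifies — and yet NO isomorphism `Π_{U_{X}}(s₁) = Π ⥲ ℤ/2 × Π = Π_{U_X}(s₂)` is
compatible with the identity of `Π`. [cite: MochizukiAbsTopII2013, Cor 3.4 pp.69-70] -/
theorem exists_cor_3_4_countermodel (p : ℕ) [Fact p.Prime] :
    ∃ (𝒟 : ConstructionDataClass.{0}) (M : EllipticModel 𝒟) (b : 𝒟.Base) (X : (𝒟.datum b).Obj)
      (s₁ s₂ : M.Setting b X),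
      𝒟.IsChainFull ∧ 𝒟.RelIsomDGC ∧ M.IsCor33Member b X ∧ M.level s₁ = M.level s₂ ∧
        IsSigmaInteger ((𝒟.datum b).primes ∩ (𝒟.datum b).primes) (M.level s₁) ∧
        (∃ (l : ℕ) (_ : Fact l.Prime), l ∈ (𝒟.datum b).primes ∧ l ∈ (𝒟.datum b).primes ∧
          IsOpen (Set.range (AbsTopIII.cyclotomicChar (𝒟.fld b) l)) ∧
          IsOpen (Set.range (AbsTopIII.cyclotomicChar (𝒟.fld b) l))) ∧
        ¬ ∃ φU : (M.cuspUX s₁).ext.arith ≃ₜ* (M.cuspUX s₂).ext.arith,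
            ∀ x, (M.cuspUX s₂).hom.arith (φU x) = (M.cuspUX s₁).hom.arith x := by
  -- the genuine base field `ℚ_p`: `G = G_{ℚ_p}` is slim and `χ_p` has open image (tree theorems)
  let G : ProfiniteGrp.{0} := absoluteGaloisGrp ℚ_[p]
  have hG : IsSlimGroup G :=
    IsSubpadicFor.isSlimGroup_absoluteGaloisGroup (AbsTopIII.IsSubpadicFor.padic p)
  have hsub : AbsTopIII.IsSubpadic ℚ_[p] := ⟨⟨p, inferInstance, AbsTopIII.IsSubpadicFor.padic p⟩⟩
  have hχ : IsOpen (Set.range (AbsTopIII.cyclotomicChar ℚ_[p] p)) :=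
    hsub.isOpen_range_cyclotomicChar p
  -- `Δ := P = ℤ_p ⋊ (1 + pℤ_p)` (slim, nontrivial), `Π := P × G ↠ G`, and `F := ℤ/2`
  let P : Type := Iw p
  have hPslim : IsSlimGroup P := ⟨Literature.AnabelianGeometry.SemiGraphs.Iw.centralizer_eq_bot_of_isOpen⟩
  let F : Type := Multiplicative (ZMod 2)
  let A : AugmentedProfiniteGrp G :=
    { arith := ProfiniteGrp.of (P × G)
      aug := ContinuousMonoidHom.snd P G
      aug_surjective := fun g => ⟨(1, g), rfl⟩ }
  let E : FundamentalExtension.{0} := A.toExtension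
  -- the second "cuspidalization" `F × Π ↠ Π`
  let E₁ : FundamentalExtension.{0} :=
    { arith := ProfiniteGrp.of (F × (P × G))
      gal := G
      aug := (ContinuousMonoidHom.snd P G).comp (ContinuousMonoidHom.snd F (P × G))
      aug_surjective := fun g => ⟨(1, (1, g)), rfl⟩ }
  let π : E₁ ⟶ E :=
    { arith := ContinuousMonoidHom.snd F (P × G)
      gal := ContinuousMonoidHom.id G
      comm := fun _ => rfl }
  let C₀ : Cuspidalization E := ⟨E, 𝟙 E, fun x => ⟨x, rfl⟩, Function.bijective_id⟩
  let C₁ : Cuspidalization E := ⟨E₁, π, fun y => ⟨(1, y), rfl⟩, Function.bijective_id⟩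
  -- the datum, the class, the (empty) cuspidal data, the model
  let D : RelativeAnabelianDatum G :=
    { Obj := PUnit.{1}, Hom := fun _ _ => A.OuterHom A, IsIso := fun c => c.IsIso,
      IsHyperbolicCurve := fun _ => True, primes := Set.univ, grp := fun _ => A,
      outerHom := fun c => c }
  let 𝒟 : ConstructionDataClass.{0} :=
    { Base := PUnit.{1}, fld := fun _ => ℚ_[p], instField := fun _ => inferInstance,
      instCharZero := fun _ => inferInstance, datum := fun _ => D, Mem := fun _ _ => True,
      IsHyperbolicOrbicurve := fun _ _ => True,
      isHyperbolicOrbicurve_of_isHyperbolicCurve := fun _ _ _ => trivial,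
      chainTerms := fun _ _ => ∅ }
  let noCusps : ∀ E' : FundamentalExtension.{0}, CuspidalData E' := fun E' =>
    { Cusp := PEmpty.{1}, Dcusp := fun x => x.elim, Icusp := fun x => x.elim,
      Icusp_eq := fun x => x.elim, isClosed_Dcusp := fun x => x.elim,
      eq_of_conj := fun x => x.elim }
  let M : EllipticModel 𝒟 :=
    { cusps := fun _ _ => noCusps _
      IsEllipticallyAdmissible := fun _ _ => True
      coreExt := fun b X => (𝒟.datum b).ext X
      toCore := fun _ _ => 𝟙 _
      toCore_isOpenInjective := fun _ _ => Hom.IsOpenInjective.id _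
      toCore_gal_bijective := fun _ _ => Function.bijective_id
      doubleCovers := fun _ _ => Set.univ
      Setting := fun _ _ => Bool
      PiD := fun _ => ⊤, PiD_mem := fun _ => Set.mem_univ _
      galOpen := fun _ => ⊤, normal_galOpen := fun _ => inferInstance
      isOpen_galOpen := fun _ => isOpen_univ
      level := fun _ => 1
      level_isSigmaInteger := fun _ => ⟨Nat.one_pos, fun q _ _ => Set.mem_univ q⟩
      PiV := fun _ => ⊤, normal_PiV := fun _ => inferInstance, isOpen_PiV := fun _ => isOpen_univ
      PiV_le := fun _ _ _ => Subgroup.mem_comap.mpr (Subgroup.mem_top _)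
      map_PiV_le := fun _ => le_top
      cuspUX := fun s => cond s C₁ C₀
      proSet_geom_cuspUX := fun _ => ⟨fun _ _ _ q _ _ => Set.mem_univ q⟩
      cuspsUX := fun _ => noCusps _ }
  -- `Δ = P × 1` is slim (transport from `P`) and nontrivial
  have hΔ : IsSlimGroup E.geom := by
    refine isSlimGroup_of_continuousMulEquiv (G := P) ?_ hPslim
    exact
      { toFun := fun x => ⟨(x, 1), rfl⟩
        invFun := fun y => y.1.1
        left_inv := fun _ => rfl
        right_inv := fun y => Subtype.ext (Prod.ext rfl y.2.symm)
        map_mul' := fun _ _ => Subtype.ext (Prod.ext rfl (one_mul 1).symm)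
        continuous_toFun := (continuous_id.prodMk continuous_const).subtype_mk _
        continuous_invFun := continuous_fst.comp continuous_subtype_val }
  have hne : E.geom ≠ ⊥ := by
    intro h
    let x : E.arith := ((⟨1, 0⟩ : Iw p), (1 : G))
    have hx : x ∈ E.geom := rfl
    have hx1 : x = 1 := (Subgroup.eq_bot_iff_forall _).mp h x hx
    have ha := congrArg (fun y : E.arith => (y.1 : Iw p).a) hx1
    change (1 : ℤ_[p]) = 0 at ha
    exact one_ne_zero ha
  -- the `𝒟`-hypotheses and the standing hypotheses
  have hfull : 𝒟.IsChainFull := fun _ _ _ t ht => ((Set.mem_empty_iff_false t).mp ht).elim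
  have hGC : 𝒟.RelIsomDGC := fun _ _ _ _ _ => Set.bijOn_id _
  have hX : M.IsCor33Member PUnit.unit PUnit.unit :=
    { mem := trivial
      ellipticallyAdmissible := trivial
      slim := hG
      cyclotomic := ⟨p, inferInstance, Set.mem_univ p, hχ⟩
      geom_slim := hΔ
      geom_ne_bot := hne }
  -- no `φ_U : Π ⥲ F × Π` over the identity of `Π`
  have hno : ¬ ∃ φU : (M.cuspUX (b := PUnit.unit) (X := PUnit.unit) false).ext.arith ≃ₜ*
        (M.cuspUX (b := PUnit.unit) (X := PUnit.unit) true).ext.arith,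
      ∀ x, (M.cuspUX (b := PUnit.unit) (X := PUnit.unit) true).hom.arith (φU x) =
        (M.cuspUX (b := PUnit.unit) (X := PUnit.unit) false).hom.arith x := by
    rintro ⟨φU, hφU⟩
    change (P × G) ≃ₜ* (F × (P × G)) at φU
    have key : ∀ y : F × (P × G), φU.symm y = y.2 := fun y => by
      have h : (φU (φU.symm y)).2 = φU.symm y := hφU (φU.symm y)
      rw [ContinuousMulEquiv.apply_symm_apply] at h
      exact h.symm
    have h1 : φU.symm (Multiplicative.ofAdd 1, 1) = φU.symm (1, 1) := by rw [key, key]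
    have h2 : Multiplicative.ofAdd (1 : ZMod 2) = (1 : Multiplicative (ZMod 2)) :=
      congrArg Prod.fst (φU.symm.injective h1)
    have h3 : (1 : ZMod 2) = 0 := congrArg Multiplicative.toAdd h2
    exact absurd h3 (by decide)
  refine ⟨𝒟, M, PUnit.unit, PUnit.unit, false, true, hfull, hGC, hX, rfl,
    ⟨Nat.one_pos, fun q _ _ => ⟨Set.mem_univ q, Set.mem_univ q⟩⟩,
    ⟨p, inferInstance, Set.mem_univ p, Set.mem_univ p, hχ, hχ⟩, hno⟩

/-! ### F-0292: Corollary 3.4 relative to `(𝒟, M)` is not a theorem for all `(𝒟, M)` -/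

/-- **F-0292 — the schema `EllipticModel.Cor_3_4` fails at a model meeting every typed hypothesis**:
there are a chain-full class `𝒟` for which the rel-isom-DGC holds and a model `M` with a member
satisfying the standing hypotheses of Cor 3.4 (over the genuine field `ℚ_2`), such that `¬ M.Cor_3_4`
(witness: `exists_cor_3_4_countermodel 2`, `φ := id`).  The row is thus a SCHEMA to be consumed at the
intended (étale-`π₁`) instance only; this says nothing about the published Corollary 3.4.
[cite: MochizukiAbsTopII2013, Cor 3.4 pp.69-70] -/
theorem exists_not_cor_3_4 :
    ∃ (𝒟 : ConstructionDataClass.{0}) (M : EllipticModel 𝒟),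
      𝒟.IsChainFull ∧ 𝒟.RelIsomDGC ∧ (∃ (b : 𝒟.Base) (X : (𝒟.datum b).Obj), M.IsCor33Member b X) ∧
        ¬ M.Cor_3_4 := by
  haveI : Fact (Nat.Prime 2) := ⟨Nat.prime_two⟩
  obtain ⟨𝒟, M, b, X, s₁, s₂, hfull, hGC, hX, hlev, hN, hcyc, hno⟩ := exists_cor_3_4_countermodel 2
  refine ⟨𝒟, M, hfull, hGC, ⟨b, X, hX⟩, fun h34 => hno ?_⟩
  obtain ⟨⟨φU, hφU⟩, -⟩ := h34 hfull hGC b b X X hX hX s₁ s₂ hlev hN hcyc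
    (ContinuousMulEquiv.refl _) (by
      ext x
      simp only [Subgroup.mem_map]
      constructor
      · rintro ⟨y, hy, rfl⟩; exact hy
      · exact fun hx => ⟨x, hx, rfl⟩)
  exact ⟨φU, fun x => hφU x⟩

/-- **F-0292 — the universal closure of `EllipticModel.Cor_3_4` over `(𝒟, M)` is FALSE.**
[cite: MochizukiAbsTopII2013, Cor 3.4 pp.69-70] -/
theorem not_forall_cor_3_4 :
    ¬ ∀ (𝒟 : ConstructionDataClass.{0}) (M : EllipticModel 𝒟), M.Cor_3_4 := by
  intro h
  obtain ⟨𝒟, M, -, -, -, h34⟩ := exists_not_cor_3_4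
  exact h34 (h 𝒟 M)

/-! ### F-0294: `RealizesCore` is a predicate, false on the trivial chain -/

/-- **F-0294 — `EllipticModel.RealizesCore` fails somewhere**: for the member of
`exists_cor_3_4_countermodel 2` (so `Π`, `Δ` slim, `Δ ≠ 1` honestly), the trivial `Π`-chain of length
`0` has type-chain `[]`, not `[⋎]`, hence does not realize the core.  `RealizesCore` is the defining
predicate of Cor 3.3 (i) ("the chain `X_{k'} ⇝ C` of type `⋎` realizing `Π_C`"), not an assertion.
[cite: MochizukiAbsTopII2013, Cor 3.3 (i) p.67] -/
theorem exists_not_realizesCore :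
    ∃ (𝒟 : ConstructionDataClass.{0}) (M : EllipticModel 𝒟) (b : 𝒟.Base) (X : (𝒟.datum b).Obj)
      (hP : IsSlimGroup ((𝒟.datum b).ext X).arith) (hΔ : IsSlimGroup ((𝒟.datum b).ext X).geom)
      (hne : ((𝒟.datum b).ext X).geom ≠ ⊥)
      (c : ((𝒟.datum b).ext X).PiChain (M.cusps b X) hP hΔ hne), ¬ M.RealizesCore b X c := by
  haveI : Fact (Nat.Prime 2) := ⟨Nat.prime_two⟩
  obtain ⟨𝒟, M, b, X, -, -, -, -, hX, -⟩ := exists_cor_3_4_countermodel 2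
  refine ⟨𝒟, M, b, X, hX.arith_slim, hX.geom_slim, hX.geom_ne_bot,
    { len := 0
      term := fun _ => ChainGroup.self hX.arith_slim hX.geom_slim hX.geom_ne_bot
      term_zero := rfl
      types := Fin.elim0
      isElemOp := fun j => j.elim0 }, fun h => ?_⟩
  have h1 := h.1
  simp [PiChain.typeChain] at h1

/-- **F-0294 — the universal closure of `EllipticModel.RealizesCore` over
`(𝒟, M, b, X, hP, hΔ, hne, c)` is FALSE.** [cite: MochizukiAbsTopII2013, Cor 3.3 (i) p.67] -/
theorem not_forall_realizesCore :
    ¬ ∀ (𝒟 : ConstructionDataClass.{0}) (M : EllipticModel 𝒟) (b : 𝒟.Base) (X : (𝒟.datum b).Obj)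
        (hP : IsSlimGroup ((𝒟.datum b).ext X).arith) (hΔ : IsSlimGroup ((𝒟.datum b).ext X).geom)
        (hne : ((𝒟.datum b).ext X).geom ≠ ⊥)
        (c : ((𝒟.datum b).ext X).PiChain (M.cusps b X) hP hΔ hne), M.RealizesCore b X c := by
  intro h
  obtain ⟨𝒟, M, b, X, hP, hΔ, hne, c, hc⟩ := exists_not_realizesCore
  exact hc (h 𝒟 M b X hP hΔ hne c)

/-! ### F-0293: `Matches` is a predicate, false when the levels disagree -/

/-- **F-0293 — `EllipticModel.Matches` fails somewhere**: over the DEGENERATE class with the single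
field `Q̄` (`G_{Q̄} = 1`, `Π = 1`, no scheme morphisms) and a model whose unique setting has `N = 2`,
the degenerate `EllipticCuspidalization` (core `ℤ/2 ↠ 1`, `Π_D = 1`, `N = 1`, `Σ = ∅` — the record of
`EllipticCuspidalization.exists_nonempty_degenerate`, rebuilt over `G_{Q̄}`) does not match the
setting (`1 ≠ 2`).  `Matches` is the defining predicate of the typed Cor 3.3 (iii), not an assertion.
[cite: MochizukiAbsTopII2013, Cor 3.3 (iii) p.68] -/
theorem exists_not_matches :
    ∃ (𝒟 : ConstructionDataClass.{0}) (M : EllipticModel 𝒟) (b : 𝒟.Base) (X : (𝒟.datum b).Obj)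
      (s : M.Setting b X) (C : EllipticCuspidalization ((𝒟.datum b).ext X)), ¬ M.Matches s C := by
  -- the algebraically closed base field `Q̄`: `G = G_{Q̄}` is trivial
  let K : Type := AlgebraicClosure ℚ
  let G : ProfiniteGrp.{0} := absoluteGaloisGrp K
  haveI hG : Subsingleton G := by
    change Subsingleton (AlgebraicClosure K ≃ₐ[K] AlgebraicClosure K)
    refine ⟨fun σ τ => AlgEquiv.ext fun x => ?_⟩
    obtain ⟨y, rfl⟩ :=
      (IsAlgClosed.algebraMap_bijective_of_isIntegral (k := K) (K := AlgebraicClosure K)).2 x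
    rw [AlgEquiv.commutes, AlgEquiv.commutes]
  -- `Π := G ↠ G`, the two-element group `T = ℤ/2`, the core `T ↠ G`
  let T : Type := Multiplicative (ZMod 2)
  let A : AugmentedProfiniteGrp G :=
    { arith := G, aug := ContinuousMonoidHom.id G, aug_surjective := Function.surjective_id }
  let E : FundamentalExtension.{0} := A.toExtension
  haveI hE : Subsingleton E.arith := hG
  let C₀ : FundamentalExtension.{0} :=
    { arith := ProfiniteGrp.of T, gal := G, aug := 1,
      aug_surjective := fun g => ⟨1, Subsingleton.elim _ _⟩ }
  let f : E ⟶ C₀ :=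
    { arith := 1, gal := ContinuousMonoidHom.id G, comm := fun _ => Subsingleton.elim _ _ }
  have hf_range : f.arith.toMonoidHom.range = (⊥ : Subgroup C₀.arith) := by
    refine le_antisymm ?_ bot_le
    rintro y ⟨x, rfl⟩
    exact Subgroup.mem_bot.2 rfl
  let noCusps : ∀ E' : FundamentalExtension.{0}, CuspidalData E' := fun E' =>
    { Cusp := PEmpty.{1}, Dcusp := fun x => x.elim, Icusp := fun x => x.elim,
      Icusp_eq := fun x => x.elim, isClosed_Dcusp := fun x => x.elim,
      eq_of_conj := fun x => x.elim }
  -- the degenerate output record (cf. `EllipticCuspidalization.exists_nonempty_degenerate`)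
  let C : EllipticCuspidalization E :=
    { N := 1
      Sigma := ∅
      N_isSigmaInteger := ⟨Nat.one_pos, fun q hq h1 => absurd (Nat.dvd_one.1 h1) hq.one_lt.ne'⟩
      core := C₀
      toCore := f
      toCore_isOpenInjective :=
        { arith_injective := Function.injective_of_subsingleton _
          isOpen_range_arith := isOpen_discrete _
          gal_injective := Function.injective_id
          isOpen_range_gal := by
            rw [Set.range_eq_univ.mpr (show Function.Surjective f.gal from fun x => ⟨x, rfl⟩)]
            exact isOpen_univ }
      toCore_gal_bijective := Function.bijective_id
      PiD := ⊥, isOpen_PiD := isOpen_discrete _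
      index_PiD := by
        rw [Subgroup.index_bot]
        change Nat.card (Multiplicative (ZMod 2)) = 2
        rw [Nat.card_congr Multiplicative.toAdd, Nat.card_zmod]
      torsionFree_PiD := ⟨fun n _ a b _ =>
        Subtype.ext ((Subgroup.mem_bot.1 (Subgroup.mem_inf.1 a.2).1).trans
          (Subgroup.mem_bot.1 (Subgroup.mem_inf.1 b.2).1).symm)⟩
      PiV := ⊤, normal_PiV := inferInstance, isOpen_PiV := isOpen_univ
      map_PiV_le := by
        rintro y ⟨x, -, rfl⟩
        exact Subgroup.mem_bot.2 rfl
      cuspU := E, projU := f, range_projU := hf_range, projU_gal_bijective := Function.bijective_id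
      cuspUX := E, proj := 𝟙 E
      proj_arith_surjective := Function.surjective_id, proj_gal_bijective := Function.bijective_id
      glue :=
        { toFun := fun _ => 1
          invFun := fun _ => 1
          left_inv := fun x => Subtype.ext (Subsingleton.elim _ _)
          right_inv := fun x => Subtype.ext (Subsingleton.elim _ _)
          map_mul' := fun _ _ => (mul_one _).symm }
      glue_comm := fun _ => rfl
      lifting_unique := fun ρ ρ' _ _ _ _ => MonoidHom.ext fun g => by
        rw [Subsingleton.elim g 1, map_one, map_one]
      center_PiUV_eq_bot := eq_bot_iff.2 fun x _ =>
        Subgroup.mem_bot.2 (Subtype.ext (Subsingleton.elim _ _))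
      cusps := noCusps _ }
  -- the datum (no scheme morphisms), the class over `Q̄`, the model with `N = 2`
  let D : RelativeAnabelianDatum G :=
    { Obj := PUnit.{1}, Hom := fun _ _ => PEmpty.{1}, IsIso := fun _ => True,
      IsHyperbolicCurve := fun _ => True, primes := Set.univ, grp := fun _ => A,
      outerHom := fun f => f.elim }
  let 𝒟 : ConstructionDataClass.{0} :=
    { Base := PUnit.{1}, fld := fun _ => K, instField := fun _ => inferInstance,
      instCharZero := fun _ => inferInstance, datum := fun _ => D, Mem := fun _ _ => True,
      IsHyperbolicOrbicurve := fun _ _ => True,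
      isHyperbolicOrbicurve_of_isHyperbolicCurve := fun _ _ _ => trivial,
      chainTerms := fun _ _ => ∅ }
  let M : EllipticModel 𝒟 :=
    { cusps := fun _ _ => noCusps _
      IsEllipticallyAdmissible := fun _ _ => True
      coreExt := fun b X => (𝒟.datum b).ext X
      toCore := fun _ _ => 𝟙 _
      toCore_isOpenInjective := fun _ _ => Hom.IsOpenInjective.id _
      toCore_gal_bijective := fun _ _ => Function.bijective_id
      doubleCovers := fun _ _ => Set.univ
      Setting := fun _ _ => PUnit.{1}
      PiD := fun _ => ⊤, PiD_mem := fun _ => Set.mem_univ _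
      galOpen := fun _ => ⊤, normal_galOpen := fun _ => inferInstance
      isOpen_galOpen := fun _ => isOpen_univ
      level := fun _ => 2
      level_isSigmaInteger := fun _ => ⟨Nat.succ_pos 1, fun q _ _ => Set.mem_univ q⟩
      PiV := fun _ => ⊤, normal_PiV := fun _ => inferInstance, isOpen_PiV := fun _ => isOpen_univ
      PiV_le := fun _ _ _ => Subgroup.mem_comap.mpr (Subgroup.mem_top _)
      map_PiV_le := fun _ => le_top
      cuspUX := fun _ => ⟨_, 𝟙 _, Function.surjective_id, Function.bijective_id⟩
      proSet_geom_cuspUX := fun _ => ⟨fun _ _ _ q _ _ => Set.mem_univ q⟩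
      cuspsUX := fun _ => noCusps _ }
  refine ⟨𝒟, M, PUnit.unit, PUnit.unit, PUnit.unit, C, fun h => ?_⟩
  have h1 : (1 : ℕ) = 2 := h.1
  exact absurd h1 (by decide)

/-- **F-0293 — the universal closure of `EllipticModel.Matches` over `(𝒟, M, b, X, s, C)` is FALSE.**
[cite: MochizukiAbsTopII2013, Cor 3.3 (iii) p.68] -/
theorem not_forall_matches :
    ¬ ∀ (𝒟 : ConstructionDataClass.{0}) (M : EllipticModel 𝒟) (b : 𝒟.Base) (X : (𝒟.datum b).Obj)
        (s : M.Setting b X) (C : EllipticCuspidalization ((𝒟.datum b).ext X)), M.Matches s C := by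
  intro h
  obtain ⟨𝒟, M, b, X, s, C, hC⟩ := exists_not_matches
  exact hC (h 𝒟 M b X s C)

end EllipticModel

end Literature.AnabelianGeometry.AbsoluteAnabelian.AbsTopII
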